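import Summits.Ventures.PercRepro.GenQNearEndPieces

/-!
# PercRepro — the near-end three pieces at EVERY level (night-4, gen 10)

The three-piece structure of the `(6, 4)` residue of record, at the near end of the type-`q` window of the
`(q + 3, q + 1)` row, for EVERY `q ≥ 1` (gen 8's `jq_seven_six_of_three_pieces` is the instance `q = 6`): for a
coloop-free rank-`(q + 1)` set `G` of `n` points, either
* NO rank-`q` flat trace has `≥ n − 2` points — the BRANCH, where a profile-LP certificate gives
  `0 ≤ Jq M G (q + 1) q`; or
* some rank-`q` flat `H` has `|G ∖ H| ≤ 2`; with `τ = H ∩ G`: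
  - `rk τ ≤ q − 1`: every spanning subset contains `G ∖ H` and NOTHING is demanded at type `q`
    (`jq_succ_nonneg_of_small_complement`);
  - `rk τ = q`, `G = τ ∪ {a}`: `Jq` IS the level-`(q + 1)` trace sum on `τ` (`Jq_hyp_add_one_eq`) — the (β₁) piece;
  - `rk τ = q`, `G = τ ∪ {a, a′}`: `Jq ≥ hypAddTwoProfile` (`Jq_hyp_add_two_ge_profile`) — the (β₂) piece.
`jq_succ_of_three_pieces`: BRANCH → (β₁) → (β₂) → `0 ≤ Jq M G (q + 1) q` for every such `G`, at every level;
`jq_succ_of_four_pieces`: the same at branch depth `3` with the «hyperplane + 3 points» SHAPE as the fourth piece;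
`traceSum_succ_of_branch_and_shapes`: the trace layer (rank-`q` sets, traces of rank-`(q − 1)` flats) from the branch
and the shapes «trace + `j` points», `2 ≤ j ≤ t`.  At `q = 6` these are gen 8's theorems; at `q = 7` they are the
near-end reduction of the `(10, 8)` row, and so on — the pieces (β₁), (β₂) and the shapes are the ONE statement
family the diagonal's near end needs at every rank.
-/
namespace PercRepro.GenQ

open Finset ThmH SixFour PerFlat Star

variable {α : Type*} [DecidableEq α] {M : Matroid α} [M.Finite]

/-- **The small-complement trivial piece at every level**: `H` a rank-`q` flat with `|G ∖ H| ≤ 2` and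
`rk(H ∩ G) + 1 ≤ q`, `rk G = q + 1`: every spanning subset contains `G ∖ H`, so `G ∖ B ⊆ H ∩ G` has rank `≤ q − 1`
and nothing is demanded at type `q`. -/
theorem jq_succ_nonneg_of_small_complement {G H : Finset α} {q : ℕ} (hX : (G \ H).card ≤ 2)
    (hτ : M.eRk ((H ∩ G : Finset α) : Set α) + 1 ≤ (q : ℕ∞)) : 0 ≤ Jq M G (q + 1) q := by
  rw [Jq_eq_sum_dem]
  refine Finset.sum_nonneg (fun B hB => ?_)
  have hB' := mem_Rq.1 hB
  have hsub : G \ B ⊆ H ∩ G := by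
    intro x hx
    rw [Finset.mem_sdiff] at hx
    rw [Finset.mem_inter]
    refine ⟨?_, hx.1⟩
    by_contra hxH
    have hBsub : B ⊆ (H ∩ G) ∪ ((G \ H).erase x) := by
      intro y hy
      rw [Finset.mem_union, Finset.mem_inter, Finset.mem_erase, Finset.mem_sdiff]
      have hyG : y ∈ G := hB'.1 hy
      by_cases hyH : y ∈ H
      · exact Or.inl ⟨hyH, hyG⟩
      · exact Or.inr ⟨fun h => hx.2 (h ▸ hy), hyG, hyH⟩
    have hcardY : ((G \ H).erase x).card ≤ 1 := by
      have h1 := Finset.card_erase_of_mem (show x ∈ G \ H from Finset.mem_sdiff.2 ⟨hx.1, hxH⟩)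
      omega
    have h2 : M.eRk (B : Set α) ≤ M.eRk ((H ∩ G : Finset α) : Set α) + (((G \ H).erase x).card : ℕ∞) :=
      (M.eRk_mono (Finset.coe_subset.2 hBsub)).trans (eRk_union_le_eRk_add_card _ _)
    have h3 : M.eRk (B : Set α) ≤ (q : ℕ∞) := by
      calc M.eRk (B : Set α) ≤ M.eRk ((H ∩ G : Finset α) : Set α) + (((G \ H).erase x).card : ℕ∞) := h2
        _ ≤ M.eRk ((H ∩ G : Finset α) : Set α) + 1 := add_le_add le_rfl (by exact_mod_cast hcardY)
        _ ≤ (q : ℕ∞) := hτ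
    rw [hB'.2] at h3
    have h4 : (q + 1 : ℕ) ≤ q := by exact_mod_cast h3
    omega
  have hdem : dem M G q B = 0 := by
    unfold dem
    rw [if_pos]
    have h1 : M.eRk ((G \ B : Finset α) : Set α) ≤ M.eRk ((H ∩ G : Finset α) : Set α) :=
      M.eRk_mono (Finset.coe_subset.2 hsub)
    exact (add_le_add h1 le_rfl).trans hτ
  rw [hdem, mul_zero, sub_zero]
  have := wInf_pos (M := M) B
  have hc : (0 : ℚ) ≤ ((q + 1 : ℕ) : ℚ) + 2 - (q : ℚ) := by push_cast; linarith
  positivity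

/-- **The near-end type-`q` balance at level `q + 1` from three pieces** (branch depth `2`, every `q ≥ 1`): the BRANCH
certificate (`hcert`: on the sets with no rank-`q` flat trace of `≥ n − 2` points), the (β₁) piece `hone` (the
level-`(q + 1)` trace sum at type `q` on every rank-`q` set of `n − 1` points) and the (β₂) piece `htwo`
(`hypAddTwoProfile ≥ 0` on every rank-`q` set of `n − 2` points with two points outside its closure) give
`0 ≤ Jq M G (q + 1) q` on EVERY coloop-free rank-`(q + 1)` set `G` of `n` points of the ground set. -/
theorem jq_succ_of_three_pieces {q n : ℕ} (hq : 1 ≤ q)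
    (hcert : ∀ G : Finset α, G ⊆ gr M → M.eRk (G : Set α) = ((q + 1 : ℕ) : ℕ∞) → G.card = n → mTr M G = 0 →
      (∀ H ∈ flatsQ M q, (H ∩ G).card + 2 < G.card) → 0 ≤ Jq M G (q + 1) q)
    (hone : ∀ τ : Finset α, τ ⊆ gr M → M.eRk (τ : Set α) = (q : ℕ∞) → τ.card + 1 = n →
      0 ≤ ∑ B ∈ Rq M τ q, ((((q + 1 : ℕ) : ℚ) + 2 - (q : ℚ)) * (1 / (2 + (mTr M B : ℚ))) -
        ((((q + 1 : ℕ) : ℚ) + 2) / (((q + 1 : ℕ) : ℚ) + 1)) * dem M τ q B))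
    (htwo : ∀ (τ : Finset α) (a a' : α), τ ⊆ gr M → M.eRk (τ : Set α) = (q : ℕ∞) → τ.card + 2 = n →
      a ∈ gr M → a' ∈ gr M → a ≠ a' → a ∉ τ → a' ∉ τ → a ∉ M.closure (τ : Set α) → a' ∉ M.closure (τ : Set α) →
      M.eRk ((insert a (insert a' τ) : Finset α) : Set α) = (q : ℕ∞) + 1 → 0 ≤ hypAddTwoProfile M τ a a' q q)
    (G : Finset α) (hG : G ⊆ gr M) (hrG : M.eRk (G : Set α) = ((q + 1 : ℕ) : ℕ∞)) (hcard : G.card = n)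
    (hmG : mTr M G = 0) : 0 ≤ Jq M G (q + 1) q := by
  by_cases hbig : ∀ H ∈ flatsQ M q, (H ∩ G).card + 2 < G.card
  · exact hcert G hG hrG hcard hmG hbig
  obtain ⟨H, hH, hle⟩ : ∃ H ∈ flatsQ M q, G.card ≤ (H ∩ G).card + 2 := by
    by_contra h
    exact hbig (fun H hH => by
      by_contra h2
      exact h ⟨H, hH, by omega⟩)
  have hX : (G \ H).card ≤ 2 := by
    rw [PercRepro.Night4.card_sdiff_eq_card_sub_card_inter]
    omega
  -- the rank of the trace
  obtain ⟨k, hk⟩ := exists_eRk_eq_nat (M := M) (H ∩ G)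
  have hkq : k ≤ q := by
    have := PercRepro.Night4.eRk_inter_le_of_flatsQ (G := G) hH
    rw [hk] at this
    exact_mod_cast this
  by_cases hk5 : k + 1 ≤ q
  · exact jq_succ_nonneg_of_small_complement hX (by rw [hk]; exact_mod_cast hk5)
  have hkq' : k = q := by omega
  have hrτ : M.eRk ((H ∩ G : Finset α) : Set α) = (q : ℕ∞) := by rw [hk, hkq']
  have hτG : H ∩ G ⊆ G := Finset.inter_subset_right
  have hτgr : H ∩ G ⊆ gr M := hτG.trans hG
  -- `G = (H ∩ G) ∪ (G ∖ H)`, `|G ∖ H| ∈ {1, 2}`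
  have hGeq : G = (H ∩ G) ∪ (G \ H) := by
    ext x
    simp only [Finset.mem_union, Finset.mem_inter, Finset.mem_sdiff]
    tauto
  have hXne : (G \ H).card ≠ 0 := by
    intro h0
    rw [Finset.card_eq_zero] at h0
    rw [hGeq, h0, Finset.union_empty, hrτ] at hrG
    have : (q : ℕ) = q + 1 := by exact_mod_cast hrG
    omega
  have hcoloop : ∀ x ∈ G, x ∉ M.closure ((G.erase x : Finset α) : Set α) → False := by
    intro x hx hxcl
    have : x ∈ coloopsOf M G := mem_coloopsOf.2 ⟨hx, hxcl⟩
    have h1 : 0 < mTr M G := by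
      unfold mTr
      exact Finset.card_pos.2 ⟨x, this⟩
    omega
  have hrank_absurd : ∀ {h : ((q + 1 : ℕ) : ℕ∞) ≤ (q : ℕ∞)}, False := by
    intro h
    have : (q + 1 : ℕ) ≤ q := by exact_mod_cast h
    omega
  rcases (show (G \ H).card = 1 ∨ (G \ H).card = 2 by omega) with h1 | h2
  · -- (β₁): `G = insert a τ`
    obtain ⟨a, ha⟩ := Finset.card_eq_one.1 h1
    have hmem : ∀ x, x ∈ G \ H ↔ x = a := by
      intro x; rw [ha, Finset.mem_singleton]
    have haG : a ∈ G := (Finset.mem_sdiff.1 ((hmem a).2 rfl)).1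
    have haH : a ∉ H := (Finset.mem_sdiff.1 ((hmem a).2 rfl)).2
    have haτ : a ∉ H ∩ G := fun h => haH (Finset.mem_inter.1 h).1
    have hGeq' : G = insert a (H ∩ G) := by
      ext x
      rw [Finset.mem_insert, Finset.mem_inter]
      constructor
      · intro hxG
        by_cases hxH : x ∈ H
        · exact Or.inr ⟨hxH, hxG⟩
        · exact Or.inl ((hmem x).1 (Finset.mem_sdiff.2 ⟨hxG, hxH⟩))
      · rintro (rfl | ⟨_, hxG⟩)
        · exact haG
        · exact hxG
    have hacl : a ∉ M.closure ((H ∩ G : Finset α) : Set α) := by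
      intro hacl
      have h := eRk_insert_le_of_mem_closure hτgr hacl
      rw [← hGeq', hrG, hrτ] at h
      exact hrank_absurd (h := h)
    have hcardτ : (H ∩ G).card + 1 = n := by
      have hc := congrArg Finset.card hGeq'
      rw [Finset.card_insert_of_notMem haτ] at hc
      omega
    rw [hGeq']
    have key := Jq_hyp_add_one_eq (M := M) (τ := H ∩ G) (q := q) (hG haG) haτ hacl hrτ q
    rw [key]
    exact hone (H ∩ G) hτgr hrτ hcardτ
  · -- (β₂): `G = insert a (insert a' τ)`
    obtain ⟨a, a', hne, ha⟩ := Finset.card_eq_two.1 h2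
    have hmem : ∀ x, x ∈ G \ H ↔ x = a ∨ x = a' := by
      intro x; rw [ha, Finset.mem_insert, Finset.mem_singleton]
    have haG : a ∈ G := (Finset.mem_sdiff.1 ((hmem a).2 (Or.inl rfl))).1
    have ha'G : a' ∈ G := (Finset.mem_sdiff.1 ((hmem a').2 (Or.inr rfl))).1
    have haH : a ∉ H := (Finset.mem_sdiff.1 ((hmem a).2 (Or.inl rfl))).2
    have ha'H : a' ∉ H := (Finset.mem_sdiff.1 ((hmem a').2 (Or.inr rfl))).2
    have haτ : a ∉ H ∩ G := fun h => haH (Finset.mem_inter.1 h).1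
    have ha'τ : a' ∉ H ∩ G := fun h => ha'H (Finset.mem_inter.1 h).1
    have hshape : ∀ x y : α, (∀ z, z ∈ G \ H ↔ z = x ∨ z = y) → x ∈ G → y ∈ G →
        G = insert x (insert y (H ∩ G)) := by
      intro x y hxy hxG hyG
      ext z
      rw [Finset.mem_insert, Finset.mem_insert, Finset.mem_inter]
      constructor
      · intro hzG
        by_cases hzH : z ∈ H
        · exact Or.inr (Or.inr ⟨hzH, hzG⟩)
        · rcases (hxy z).1 (Finset.mem_sdiff.2 ⟨hzG, hzH⟩) with rfl | rfl
          · exact Or.inl rfl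
          · exact Or.inr (Or.inl rfl)
      · rintro (rfl | rfl | ⟨_, hzG⟩)
        · exact hxG
        · exact hyG
        · exact hzG
    have herase : ∀ x y : α, x ≠ y → (∀ z, z ∈ G \ H ↔ z = x ∨ z = y) → x ∈ G → y ∉ H ∩ G →
        G.erase y = insert x (H ∩ G) := by
      intro x y hxy hxyG hxG hyτ
      ext z
      rw [Finset.mem_erase, Finset.mem_insert, Finset.mem_inter]
      constructor
      · rintro ⟨hzy, hzG⟩
        by_cases hzH : z ∈ H
        · exact Or.inr ⟨hzH, hzG⟩
        · rcases (hxyG z).1 (Finset.mem_sdiff.2 ⟨hzG, hzH⟩) with rfl | rfl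
          · exact Or.inl rfl
          · exact absurd rfl hzy
      · rintro (rfl | ⟨hzH, hzG⟩)
        · exact ⟨hxy, hxG⟩
        · exact ⟨fun h => hyτ (h ▸ Finset.mem_inter.2 ⟨hzH, hzG⟩), hzG⟩
    have hGeq' : G = insert a (insert a' (H ∩ G)) := hshape a a' hmem haG ha'G
    have hcl : ∀ x y : α, x ≠ y → (∀ z, z ∈ G \ H ↔ z = x ∨ z = y) → x ∈ G → y ∈ G → x ∉ H ∩ G → y ∉ H ∩ G →
        x ∉ M.closure ((H ∩ G : Finset α) : Set α) := by
      intro x y hxy hxyG hxG hyG hxτ hyτ hxcl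
      have hGxy : G = insert x (insert y (H ∩ G)) := hshape x y hxyG hxG hyG
      have hycl : y ∉ M.closure ((H ∩ G : Finset α) : Set α) := by
        intro hycl
        have e2 := eRk_insert_le_of_mem_closure hτgr hycl
        have e1 := eRk_insert_le_of_mem_closure (τ := insert y (H ∩ G)) (a := x)
          (Finset.insert_subset_iff.2 ⟨hG hyG, hτgr⟩)
          (M.closure_subset_closure (Finset.coe_subset.2 (Finset.subset_insert y (H ∩ G))) hxcl)
        have h1 := e1.trans e2
        rw [← hGxy, hrG, hrτ] at h1
        exact hrank_absurd (h := h1)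
      apply hcoloop y hyG
      rw [herase x y hxy hxyG hxG hyτ]
      intro hy
      apply hycl
      have hsub : ((insert x (H ∩ G) : Finset α) : Set α) ⊆ M.closure ((H ∩ G : Finset α) : Set α) := by
        rw [Finset.coe_insert]
        exact Set.insert_subset hxcl (M.subset_closure _ (by rw [← coe_gr M]; exact_mod_cast hτgr))
      exact M.closure_subset_closure_of_subset_closure hsub hy
    have hacl : a ∉ M.closure ((H ∩ G : Finset α) : Set α) := hcl a a' hne hmem haG ha'G haτ ha'τ
    have ha'cl : a' ∉ M.closure ((H ∩ G : Finset α) : Set α) :=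
      hcl a' a (Ne.symm hne) (fun z => by rw [hmem z]; exact or_comm) ha'G haG ha'τ haτ
    have hcardτ : (H ∩ G).card + 2 = n := by
      have hc := congrArg Finset.card hGeq'
      rw [Finset.card_insert_of_notMem (by
        rw [Finset.mem_insert]
        exact fun h => h.elim hne haτ), Finset.card_insert_of_notMem ha'τ] at hc
      omega
    have hrG' : M.eRk ((insert a (insert a' (H ∩ G)) : Finset α) : Set α) = (q : ℕ∞) + 1 := by
      rw [← hGeq', hrG]; push_cast; rfl
    rw [hGeq']
    have key := Jq_hyp_add_two_ge_profile (M := M) (τ := H ∩ G) (q := q) (t := q) (hG haG) (hG ha'G) hne haτ ha'τ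
      hacl ha'cl hrτ hrG' hq (Nat.le_succ q)
    exact le_trans (htwo (H ∩ G) a a' hτgr hrτ hcardτ (hG haG) (hG ha'G) hne haτ ha'τ hacl ha'cl hrG') key

/-- **Depth `3` at every level**: the branch certificate with `hbig₃` («no rank-`q` flat trace of `≥ n − 3` points»),
the pieces (β₁), (β₂) as above, and the «hyperplane + 3 points» SHAPE `hthree` (every coloop-free rank-`(q + 1)` set
`G` of `n` points with a rank-`q` flat `H`, `|G ∖ H| = 3`) give the type-`q` balance on every coloop-free
rank-`(q + 1)` set of `n` points. -/
theorem jq_succ_of_four_pieces {q n : ℕ} (hq : 1 ≤ q)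
    (hcert : ∀ G : Finset α, G ⊆ gr M → M.eRk (G : Set α) = ((q + 1 : ℕ) : ℕ∞) → G.card = n → mTr M G = 0 →
      (∀ H ∈ flatsQ M q, (H ∩ G).card + 3 < G.card) → 0 ≤ Jq M G (q + 1) q)
    (hone : ∀ τ : Finset α, τ ⊆ gr M → M.eRk (τ : Set α) = (q : ℕ∞) → τ.card + 1 = n →
      0 ≤ ∑ B ∈ Rq M τ q, ((((q + 1 : ℕ) : ℚ) + 2 - (q : ℚ)) * (1 / (2 + (mTr M B : ℚ))) -
        ((((q + 1 : ℕ) : ℚ) + 2) / (((q + 1 : ℕ) : ℚ) + 1)) * dem M τ q B))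
    (htwo : ∀ (τ : Finset α) (a a' : α), τ ⊆ gr M → M.eRk (τ : Set α) = (q : ℕ∞) → τ.card + 2 = n →
      a ∈ gr M → a' ∈ gr M → a ≠ a' → a ∉ τ → a' ∉ τ → a ∉ M.closure (τ : Set α) → a' ∉ M.closure (τ : Set α) →
      M.eRk ((insert a (insert a' τ) : Finset α) : Set α) = (q : ℕ∞) + 1 → 0 ≤ hypAddTwoProfile M τ a a' q q)
    (hthree : ∀ (G H : Finset α), G ⊆ gr M → M.eRk (G : Set α) = ((q + 1 : ℕ) : ℕ∞) → G.card = n → mTr M G = 0 →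
      H ∈ flatsQ M q → (G \ H).card = 3 → 0 ≤ Jq M G (q + 1) q)
    (G : Finset α) (hG : G ⊆ gr M) (hrG : M.eRk (G : Set α) = ((q + 1 : ℕ) : ℕ∞)) (hcard : G.card = n)
    (hmG : mTr M G = 0) : 0 ≤ Jq M G (q + 1) q := by
  by_cases hbig : ∀ H ∈ flatsQ M q, (H ∩ G).card + 3 < G.card
  · exact hcert G hG hrG hcard hmG hbig
  obtain ⟨H, hH, hle⟩ : ∃ H ∈ flatsQ M q, G.card ≤ (H ∩ G).card + 3 := by
    by_contra h
    exact hbig (fun H hH => by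
      by_contra h2
      exact h ⟨H, hH, by omega⟩)
  have hX : (G \ H).card ≤ 3 := by
    rw [PercRepro.Night4.card_sdiff_eq_card_sub_card_inter]
    omega
  by_cases h3 : (G \ H).card = 3
  · exact hthree G H hG hrG hcard hmG hH h3
  have hX2 : (G \ H).card ≤ 2 := by omega
  refine jq_succ_of_three_pieces (n := n) hq (fun G' hG' hrG' hcard' hmG' hbig' => ?_) hone htwo G hG hrG hcard hmG
  by_cases hbig3 : ∀ H' ∈ flatsQ M q, (H' ∩ G').card + 3 < G'.card
  · exact hcert G' hG' hrG' hcard' hmG' hbig3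
  obtain ⟨H', hH', hle'⟩ : ∃ H' ∈ flatsQ M q, G'.card ≤ (H' ∩ G').card + 3 := by
    by_contra h
    exact hbig3 (fun H' hH' => by
      by_contra h2
      exact h ⟨H', hH', by omega⟩)
  have h3' : (G' \ H').card = 3 := by
    have := hbig' H' hH'
    rw [PercRepro.Night4.card_sdiff_eq_card_sub_card_inter]
    have hc : (H' ∩ G').card ≤ G'.card := Finset.card_le_card Finset.inter_subset_right
    omega
  exact hthree G' H' hG' hrG' hcard' hmG' hH' h3'

/-- A rank-`q` set `H` with a rank-`(q − 1)` flat `K` and `|H ∖ K| = 1` has that point as a coloop: `H ∖ x ⊆ K` has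
rank `≤ q − 1`. -/
theorem mTr_ne_zero_of_sdiff_card_one_gen {H K : Finset α} {q : ℕ} (hrH : M.eRk (H : Set α) = ((q + 1 : ℕ) : ℕ∞))
    (hK : K ∈ flatsQ M q) (h1 : (H \ K).card = 1) : mTr M H ≠ 0 := by
  obtain ⟨x, hx⟩ := Finset.card_eq_one.1 h1
  have hxH : x ∈ H := (Finset.mem_sdiff.1 (hx ▸ Finset.mem_singleton_self x)).1
  have hsub : H.erase x ⊆ K := by
    intro y hy
    rw [Finset.mem_erase] at hy
    by_contra hyK
    have : y ∈ H \ K := Finset.mem_sdiff.2 ⟨hy.2, hyK⟩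
    rw [hx, Finset.mem_singleton] at this
    exact hy.1 this
  have hcl : x ∉ M.closure ((H.erase x : Finset α) : Set α) := by
    intro hxcl
    have h1' : M.eRk (H : Set α) ≤ M.eRk ((H.erase x : Finset α) : Set α) := by
      rw [← M.eRk_closure_eq ((H.erase x : Finset α) : Set α)]
      apply M.eRk_mono
      intro y hy
      by_cases hyx : y = x
      · rw [hyx]; exact hxcl
      · exact M.subset_closure_of_subset' (subset_refl _) (by
          rw [← coe_gr M]
          exact_mod_cast (show H.erase x ⊆ gr M from hsub.trans ((mem_flatsQ.1 hK).1))) (by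
          rw [Finset.mem_coe, Finset.mem_erase]; exact ⟨hyx, by exact_mod_cast hy⟩)
    have h2 : M.eRk ((H.erase x : Finset α) : Set α) ≤ M.eRk (K : Set α) := M.eRk_mono (Finset.coe_subset.2 hsub)
    rw [hrH, (mem_flatsQ.1 hK).2.2] at *
    have := h1'.trans h2
    have h5 : (q + 1 : ℕ) ≤ q := by exact_mod_cast this
    omega
  unfold mTr
  intro h0
  rw [Finset.card_eq_zero] at h0
  have : x ∈ coloopsOf M H := mem_coloopsOf.2 ⟨hxH, hcl⟩
  rw [h0] at this
  exact Finset.notMem_empty x this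

/-- **The trace layer from the branch and the shapes, at every level**: on the coloop-free rank-`(q + 1)` sets `H`
of `n` points, the level-`(q + 2)` trace sum at type `q + 1` is non-negative if (i) the BRANCH certificate holds (no
rank-`q` flat trace of `≥ n − t` points) and (ii) the SHAPES «rank-`q` trace + `j` points», `2 ≤ j ≤ t`, hold
(`j = 1` is impossible: `mTr_ne_zero_of_sdiff_card_one_gen`; `rk(K ∩ H) ≤ q − 1` is included in the shapes).
At `q = 5` this is gen 8's `traceSum_six_of_branch_and_shapes`. -/
theorem traceSum_succ_of_branch_and_shapes {q n t : ℕ}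
    (hcert : ∀ H : Finset α, H ⊆ gr M → M.eRk (H : Set α) = ((q + 1 : ℕ) : ℕ∞) → H.card = n → mTr M H = 0 →
      (∀ K ∈ flatsQ M q, (K ∩ H).card + t < H.card) →
      0 ≤ ∑ B ∈ Rq M H (q + 1), ((((q + 1 + 1 : ℕ) : ℚ) + 2 - ((q + 1 : ℕ) : ℚ)) * (1 / (2 + (mTr M B : ℚ))) -
        ((((q + 1 + 1 : ℕ) : ℚ) + 2) / (((q + 1 + 1 : ℕ) : ℚ) + 1)) * dem M H (q + 1) B))
    (hshape : ∀ (H K : Finset α), H ⊆ gr M → M.eRk (H : Set α) = ((q + 1 : ℕ) : ℕ∞) → H.card = n → mTr M H = 0 →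
      K ∈ flatsQ M q → 2 ≤ (H \ K).card → (H \ K).card ≤ t →
      0 ≤ ∑ B ∈ Rq M H (q + 1), ((((q + 1 + 1 : ℕ) : ℚ) + 2 - ((q + 1 : ℕ) : ℚ)) * (1 / (2 + (mTr M B : ℚ))) -
        ((((q + 1 + 1 : ℕ) : ℚ) + 2) / (((q + 1 + 1 : ℕ) : ℚ) + 1)) * dem M H (q + 1) B))
    (H : Finset α) (hH : H ⊆ gr M) (hrH : M.eRk (H : Set α) = ((q + 1 : ℕ) : ℕ∞)) (hcard : H.card = n)
    (hmH : mTr M H = 0) :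
    0 ≤ ∑ B ∈ Rq M H (q + 1), ((((q + 1 + 1 : ℕ) : ℚ) + 2 - ((q + 1 : ℕ) : ℚ)) * (1 / (2 + (mTr M B : ℚ))) -
      ((((q + 1 + 1 : ℕ) : ℚ) + 2) / (((q + 1 + 1 : ℕ) : ℚ) + 1)) * dem M H (q + 1) B) := by
  by_cases hbig : ∀ K ∈ flatsQ M q, (K ∩ H).card + t < H.card
  · exact hcert H hH hrH hcard hmH hbig
  obtain ⟨K, hK, hle⟩ : ∃ K ∈ flatsQ M q, H.card ≤ (K ∩ H).card + t := by
    by_contra h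
    exact hbig (fun K hK => by
      by_contra h2
      exact h ⟨K, hK, by omega⟩)
  have hX : (H \ K).card ≤ t := by
    rw [PercRepro.Night4.card_sdiff_eq_card_sub_card_inter]
    omega
  have hX0 : (H \ K).card ≠ 0 := by
    intro h0
    rw [Finset.card_eq_zero, Finset.sdiff_eq_empty_iff_subset] at h0
    have h1 : M.eRk (H : Set α) ≤ M.eRk (K : Set α) := M.eRk_mono (Finset.coe_subset.2 h0)
    rw [hrH, (mem_flatsQ.1 hK).2.2] at h1
    have h5 : (q + 1 : ℕ) ≤ q := by exact_mod_cast h1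
    omega
  have hX1 : (H \ K).card ≠ 1 := fun h1 => mTr_ne_zero_of_sdiff_card_one_gen hrH hK h1 hmH
  exact hshape H K hH hrH hcard hmH hK (by omega) hX

/-- The `(9, 7)` instance: gen 8's three-piece theorem is `jq_succ_of_three_pieces` at `q = 6` (a consistency check
of the generic statement against the landed one). -/
theorem jq_seven_six_of_three_pieces' {n : ℕ}
    (hcert : ∀ G : Finset α, G ⊆ gr M → M.eRk (G : Set α) = ((7 : ℕ) : ℕ∞) → G.card = n → mTr M G = 0 →
      (∀ H ∈ flatsQ M 6, (H ∩ G).card + 2 < G.card) → 0 ≤ Jq M G 7 6)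
    (hone : ∀ τ : Finset α, τ ⊆ gr M → M.eRk (τ : Set α) = ((6 : ℕ) : ℕ∞) → τ.card + 1 = n →
      0 ≤ ∑ B ∈ Rq M τ 6, ((((6 + 1 : ℕ) : ℚ) + 2 - ((6 : ℕ) : ℚ)) * (1 / (2 + (mTr M B : ℚ))) -
        ((((6 + 1 : ℕ) : ℚ) + 2) / (((6 + 1 : ℕ) : ℚ) + 1)) * dem M τ 6 B))
    (htwo : ∀ (τ : Finset α) (a a' : α), τ ⊆ gr M → M.eRk (τ : Set α) = ((6 : ℕ) : ℕ∞) → τ.card + 2 = n →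
      a ∈ gr M → a' ∈ gr M → a ≠ a' → a ∉ τ → a' ∉ τ → a ∉ M.closure (τ : Set α) → a' ∉ M.closure (τ : Set α) →
      M.eRk ((insert a (insert a' τ) : Finset α) : Set α) = ((6 : ℕ) : ℕ∞) + 1 → 0 ≤ hypAddTwoProfile M τ a a' 6 6)
    (G : Finset α) (hG : G ⊆ gr M) (hrG : M.eRk (G : Set α) = ((7 : ℕ) : ℕ∞)) (hcard : G.card = n)
    (hmG : mTr M G = 0) : 0 ≤ Jq M G 7 6 :=
  jq_succ_of_three_pieces (q := 6) (n := n) (by norm_num) hcert hone htwo G hG hrG hcard hmG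

end PercRepro.GenQ
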